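import Summits.QuantumFields.YangMills.Theorems.BalabanLadderUVSeamRecFibrePeeling
import HarnessLib

/-!
# Crux `UVSeamRec` (stmt-QuantumFields-20043): the COMPLETE TRIANGULAR PEELING FAMILY of a cold-wall cube of `ℤ⁴`

Helper file (`--supports stmt-QuantumFields-20043`) of the LEAD seat `ym-spine-20043-p1` (gen 12); sequel of `…FibrePeeling`.
For the cube `(c, b)` of `ℤ⁴` (sites `cubeSites c b`, interior links `Λ = cubeEdges c b`) call a site DEEP when all its eight neighbours are cube
sites (`c j + 1 ≤ x j ≤ c j + b − 2` for all `j`), and let the TREE `T ⊆ Λ` be the temporal comb of the deep sites: the time-like links `(y, 3)`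
whose upper end `y + e₃` is deep (`#T = (b−2)⁴`; these are the links a gauge transformation supported on the deep sites can kill — sequel
`…ColdWallCube`).  This file assigns to EVERY other interior link `ℓ ∈ Λ ∖ T` a plaquette `pl ℓ ∋ ℓ` touching the cube, triangularly for an
explicit rank `τ` (`ℓ ∈ pl ℓ'`, `ℓ ≠ ℓ'` ⇒ `τ ℓ < τ ℓ'`):
* side-wall time-like links (some spatial coordinate on the boundary of the cube) ↦ the plaquette through the link pointing OUT of the cube
  (its other three links are exterior), rank `0`;
* space-like links `(y, i)` ↦ the time-like plaquette BELOW them (`(y − e₃; i, 3)`), or ABOVE them in the top layer, rank `1 + (y₃ − c₃)`;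
* the remaining time-like links (`(y, 3)` with `y` spatially deep and `y₃ = c₃ + b − 2`, just under the top layer) ↦ `(y; 0, 3)`, rank
  `b + 1 + (c₀ + b − y₀)`.
Main results: `exists_peeling_family_cube` (the family) and, by `…FibrePeeling`, **`fibreIntegral_exp_neg_mul_cube_le_pow`**:
`Z_{(c,b)}(b'; η) ≤ ψ_ρ(b')^{#(Λ ∖ T)}` for EVERY exterior `η` and `b' ≥ 0`; `SU(2)`: `≤ (3/(b'√b'))^{#(Λ ∖ T)}`.
HONEST FRAMING: finite combinatorics of one cube; nothing of E0′, NT or the gap; not Clay.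
-/

open MeasureTheory Finset
open scoped ENNReal Matrix Matrix.Norms.Frobenius
open Literature.MathematicalPhysics.QuantumFieldTheory (haarProbability)
open Literature.MathematicalPhysics.QuantumLattice
open Literature.Probability.LatticeModels (glueWith)
open Summit.QuantumFields.YangMills.Cruxes.OSLegsFromFemtoAndGap.DlrCollarTransfer (cubeSites cubeEdges)

noncomputable section

namespace Summit.QuantumFields.YangMills.Cruxes.UVSeamRec.ClassicalResponse.ColdWall

/-! ### §1 Coordinates of the cube -/

section Coords

variable (c : Fin 4 → ℤ) (b : ℕ)

/-- Membership of a link in `cubeEdges c b`, in coordinates: both endpoints lie in `∏ [c_j, c_j + b)`. [folklore] -/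
theorem mem_cubeEdges_iff_coords (x : Fin 4 → ℤ) (i : Fin 4) :
    (x, i) ∈ cubeEdges c b ↔ (∀ j, c j ≤ x j ∧ x j < c j + b) ∧ ∀ j, c j ≤ (x + Pi.single i 1 : Fin 4 → ℤ) j ∧ (x + Pi.single i 1 : Fin 4 → ℤ) j < c j + b := by
  unfold cubeEdges cubeSites
  simp only [Finset.mem_filter, Finset.mem_product, Finset.mem_univ, and_true, Fintype.mem_piFinset, Finset.mem_Ico]

/-- Coordinates of `x + e_k`. [folklore] -/
theorem add_single_apply' (x : Fin 4 → ℤ) (k j : Fin 4) : (x + Pi.single k 1 : Fin 4 → ℤ) j = x j + if j = k then 1 else 0 := by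
  simp only [Pi.add_apply, Pi.single_apply]

/-- Coordinates of `x − e_k`. [folklore] -/
theorem sub_single_apply' (x : Fin 4 → ℤ) (k j : Fin 4) : (x - Pi.single k 1 : Fin 4 → ℤ) j = x j - if j = k then 1 else 0 := by
  simp only [Pi.sub_apply, Pi.single_apply]

/-- A link whose lower endpoint has a coordinate below the cube is not an interior link. [folklore] -/
theorem not_mem_cubeEdges_of_lt {x : Fin 4 → ℤ} {i : Fin 4} {j : Fin 4} (h : x j < c j) : (x, i) ∉ cubeEdges c b := by
  rw [mem_cubeEdges_iff_coords]
  intro hx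
  have := (hx.1 j).1
  omega

/-- A link whose lower endpoint has a coordinate beyond the cube is not an interior link. [folklore] -/
theorem not_mem_cubeEdges_of_ge {x : Fin 4 → ℤ} {i : Fin 4} {j : Fin 4} (h : c j + b ≤ x j) : (x, i) ∉ cubeEdges c b := by
  rw [mem_cubeEdges_iff_coords]
  intro hx
  have := (hx.1 j).2
  omega

/-- A link whose upper endpoint has a coordinate beyond the cube is not an interior link. [folklore] -/
theorem not_mem_cubeEdges_of_ge_add {x : Fin 4 → ℤ} {i : Fin 4} {j : Fin 4} (h : c j + b ≤ (x + Pi.single i 1 : Fin 4 → ℤ) j) :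
    (x, i) ∉ cubeEdges c b := by
  rw [mem_cubeEdges_iff_coords]
  intro hx
  have := (hx.2 j).2
  omega

omit c b in
/-- In `Fin 4`, an index different from `3` is `< 3`. [folklore] -/
theorem fin4_lt_three_of_ne {i : Fin 4} (h : i ≠ 3) : i < 3 := by
  fin_cases i
  · decide
  · decide
  · decide
  · exact absurd rfl h

end Coords

/-! ### §2 The peeling family of the cube -/

section Family

variable (c : Fin 4 → ℤ) (b : ℕ)

/-- **THE COMPLETE TRIANGULAR PEELING FAMILY OF A COLD-WALL CUBE.**  Let `Λ = cubeEdges c b` and let `T ⊆ Λ` be the temporal comb of the deep sites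
(`(y, 3)` with `y + e₃` deep).  There are `pl : links → plaquettes` and a rank `τ` such that every `ℓ ∈ Λ ∖ T` is an edge of `pl ℓ` and the family is
TRIANGULAR: `ℓ ∈ pl ℓ'`, `ℓ ≠ ℓ'`, both in `Λ ∖ T` ⇒ `τ ℓ < τ ℓ'` (side-wall time-like links peel through exterior plaquettes, space-like links through
the time-like plaquette below — above in the top layer —, the remaining time-like links under the top layer through `(y; 0, 3)`). [folklore] -/
theorem exists_peeling_family_cube :
    ∃ (pl : ZdEdge 4 → ZdPlaquette 4) (τ : ZdEdge 4 → ℕ),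
      (∀ ℓ ∈ cubeEdges c b \ (cubeEdges c b).filter (fun ℓ => ℓ.2 = 3 ∧
          ∀ j, c j + 1 ≤ (ℓ.1 + Pi.single 3 1 : Fin 4 → ℤ) j ∧ (ℓ.1 + Pi.single 3 1 : Fin 4 → ℤ) j + 2 ≤ c j + b), ℓ ∈ plaquetteEdges (pl ℓ)) ∧
      (∀ ℓ ∈ cubeEdges c b \ (cubeEdges c b).filter (fun ℓ => ℓ.2 = 3 ∧
          ∀ j, c j + 1 ≤ (ℓ.1 + Pi.single 3 1 : Fin 4 → ℤ) j ∧ (ℓ.1 + Pi.single 3 1 : Fin 4 → ℤ) j + 2 ≤ c j + b),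
        ∀ ℓ' ∈ cubeEdges c b \ (cubeEdges c b).filter (fun ℓ => ℓ.2 = 3 ∧
          ∀ j, c j + 1 ≤ (ℓ.1 + Pi.single 3 1 : Fin 4 → ℤ) j ∧ (ℓ.1 + Pi.single 3 1 : Fin 4 → ℤ) j + 2 ≤ c j + b),
        ℓ ≠ ℓ' → ℓ ∈ plaquetteEdges (pl ℓ') → τ ℓ < τ ℓ') := by
  classical
  -- side-wall predicate of a site: some spatial coordinate on the boundary of the cube
  let SW : (Fin 4 → ℤ) → Prop := fun y => ∃ k : Fin 4, k ≠ 3 ∧ (y k = c k ∨ y k + 1 = c k + b)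
  -- the family
  let pl : ZdEdge 4 → ZdPlaquette 4 := fun ℓ =>
    if h3 : ℓ.2 = 3 then
      if hsw : SW ℓ.1 then
        if Classical.choose hsw |> fun k => ℓ.1 k = c k then
          (ℓ.1 - Pi.single (Classical.choose hsw) 1, ⟨(Classical.choose hsw, 3), fin4_lt_three_of_ne (Classical.choose_spec hsw).1⟩)
        else (ℓ.1, ⟨(Classical.choose hsw, 3), fin4_lt_three_of_ne (Classical.choose_spec hsw).1⟩)
      else (ℓ.1, ⟨(0, 3), by decide⟩)
    else
      if ℓ.1 3 + 1 = c 3 + b then (ℓ.1, ⟨(ℓ.2, 3), fin4_lt_three_of_ne h3⟩)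
      else (ℓ.1 - Pi.single 3 1, ⟨(ℓ.2, 3), fin4_lt_three_of_ne h3⟩)
  let τ : ZdEdge 4 → ℕ := fun ℓ =>
    if ℓ.2 = 3 then (if SW ℓ.1 then 0 else b + 1 + (c 0 + b - ℓ.1 0).toNat) else 1 + (ℓ.1 3 - c 3).toNat
  have hτsp : ∀ (z : Fin 4 → ℤ) (k : Fin 4), k ≠ 3 → τ (z, k) = 1 + (z 3 - c 3).toNat := fun z k hk => by
    show (if k = 3 then (if SW z then 0 else b + 1 + (c 0 + b - z 0).toNat) else 1 + (z 3 - c 3).toNat) = _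
    rw [if_neg hk]
  have hτt : ∀ z : Fin 4 → ℤ, τ (z, 3) = if SW z then 0 else b + 1 + (c 0 + b - z 0).toNat := fun z => by
    show (if (3 : Fin 4) = 3 then (if SW z then 0 else b + 1 + (c 0 + b - z 0).toNat) else 1 + (z 3 - c 3).toNat) = _
    rw [if_pos rfl]
  refine ⟨pl, τ, ?_, ?_⟩
  · -- every free link is an edge of its plaquette
    intro ℓ hℓ
    obtain ⟨y, i⟩ := ℓ
    simp only [pl]
    by_cases h3 : i = 3
    · simp only [h3, dif_pos]
      by_cases hsw : SW y
      · rw [dif_pos hsw]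
        split_ifs with hk
        · simp [plaquetteEdges]
        · simp [plaquetteEdges]
      · rw [dif_neg hsw]
        simp [plaquetteEdges]
    · rw [dif_neg h3]
      split_ifs with htop
      · simp [plaquetteEdges]
      · simp [plaquetteEdges]
  · -- triangularity
    intro ℓ hℓ ℓ' hℓ' hne hmem
    obtain ⟨y, i⟩ := ℓ
    obtain ⟨y', i'⟩ := ℓ'
    rw [Finset.mem_sdiff, Finset.mem_filter] at hℓ hℓ'
    obtain ⟨hΛ, hT⟩ := hℓ
    obtain ⟨hΛ', hT'⟩ := hℓ'
    have hB := (mem_cubeEdges_iff_coords c b y i).1 hΛ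
    have hB' := (mem_cubeEdges_iff_coords c b y' i').1 hΛ'
    simp only [pl] at hmem
    by_cases h3' : i' = 3
    · subst h3'
      simp only [dif_pos] at hmem
      by_cases hsw' : SW y'
      · -- side wall: the other three edges are exterior links
        exfalso
        rw [dif_pos hsw'] at hmem
        have hk3 : Classical.choose hsw' ≠ 3 := (Classical.choose_spec hsw').1
        have hkor : y' (Classical.choose hsw') = c (Classical.choose hsw') ∨
            y' (Classical.choose hsw') + 1 = c (Classical.choose hsw') + b := (Classical.choose_spec hsw').2
        split_ifs at hmem with hlo
        · simp only [plaquetteEdges, mem_insert, mem_singleton] at hmem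
          generalize hk : Classical.choose hsw' = k at hmem hlo hk3 hkor
          rcases hmem with h | h | h | h
          · rw [h] at hΛ
            refine not_mem_cubeEdges_of_lt c b (j := k) ?_ hΛ
            rw [sub_single_apply', if_pos rfl]; omega
          · rw [sub_add_cancel] at h; exact hne h
          · rw [h] at hΛ
            refine not_mem_cubeEdges_of_lt c b (j := k) ?_ hΛ
            rw [add_single_apply', sub_single_apply', if_pos rfl, if_neg hk3]; omega
          · rw [h] at hΛ
            refine not_mem_cubeEdges_of_lt c b (j := k) ?_ hΛ
            rw [sub_single_apply', if_pos rfl]; omega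
        · simp only [plaquetteEdges, mem_insert, mem_singleton] at hmem
          generalize hk : Classical.choose hsw' = k at hmem hlo hk3 hkor
          have hhi : y' k + 1 = c k + b := hkor.resolve_left hlo
          rcases hmem with h | h | h | h
          · rw [h] at hΛ
            refine not_mem_cubeEdges_of_ge_add c b (j := k) ?_ hΛ
            rw [add_single_apply', if_pos rfl]; omega
          · rw [h] at hΛ
            refine not_mem_cubeEdges_of_ge c b (j := k) ?_ hΛ
            rw [add_single_apply', if_pos rfl]; omega
          · rw [h] at hΛ
            refine not_mem_cubeEdges_of_ge_add c b (j := k) ?_ hΛ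
            rw [add_single_apply', add_single_apply', if_pos rfl, if_neg hk3]; omega
          · exact hne h
      · -- time-like, spatially deep, under the top layer: `pl = (y'; 0, 3)`
        rw [dif_neg hsw'] at hmem
        have hsp : ∀ k : Fin 4, k ≠ 3 → c k + 1 ≤ y' k ∧ y' k + 2 ≤ c k + b := by
          intro k hk
          have h1 := hB'.1 k
          have hns : ¬(y' k = c k ∨ y' k + 1 = c k + b) := fun h => hsw' ⟨k, hk, h⟩
          rw [not_or] at hns
          omega
        have h03 : c 3 ≤ y' 3 := (hB'.1 3).1
        have hy3 : y' 3 + 2 = c 3 + b := by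
          have h1 := hB'.2 3
          rw [add_single_apply', if_pos rfl] at h1
          by_contra hne3
          refine hT' ⟨hΛ', rfl, fun j => ?_⟩
          dsimp only
          rw [add_single_apply']
          by_cases hj : j = 3
          · subst hj; rw [if_pos rfl]; omega
          · simp only [if_neg hj, add_zero]; exact hsp j hj
        have hτ' : τ (y', 3) = b + 1 + (c 0 + b - y' 0).toNat := by rw [hτt, if_neg hsw']
        rw [hτ']
        simp only [plaquetteEdges, mem_insert, mem_singleton] at hmem
        rcases hmem with h | h | h | h
        · -- `(y', 0)`: space-like at time `c₃ + b − 2`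
          rw [h, hτsp _ _ (by decide)]
          have : (y' 3 - c 3).toNat + 2 = b := by omega
          omega
        · -- `(y' + e₀, 3)`: time-like, one step further in `x₀`
          rw [h, hτt]
          split_ifs with hsw2
          · omega
          · have h0 := hsp 0 (by decide)
            rw [add_single_apply']
            simp only [if_true]
            have e1 : (c 0 + b - (y' 0 + 1)).toNat + 1 = (c 0 + b - y' 0).toNat := by omega
            omega
        · -- `(y' + e₃, 0)`: space-like in the top layer
          rw [h, hτsp _ _ (by decide), add_single_apply']
          simp only [if_true]
          have : (y' 3 + 1 - c 3).toNat + 1 = b := by omega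
          omega
        · exact absurd h hne
    · -- space-like `ℓ'`
      rw [dif_neg h3'] at hmem
      have hτ' : τ (y', i') = 1 + (y' 3 - c 3).toNat := hτsp _ _ h3'
      rw [hτ']
      split_ifs at hmem with htop
      · -- top layer: the other three edges are exterior
        exfalso
        simp only [plaquetteEdges, mem_insert, mem_singleton] at hmem
        rcases hmem with h | h | h | h
        · exact hne h
        · rw [h] at hΛ
          refine not_mem_cubeEdges_of_ge_add c b (j := 3) ?_ hΛ
          rw [add_single_apply', add_single_apply', if_pos rfl, if_neg (Ne.symm h3')]; omega
        · rw [h] at hΛ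
          refine not_mem_cubeEdges_of_ge c b (j := 3) ?_ hΛ
          rw [add_single_apply', if_pos rfl]; omega
        · rw [h] at hΛ
          refine not_mem_cubeEdges_of_ge_add c b (j := 3) ?_ hΛ
          rw [add_single_apply', if_pos rfl]; omega
      · -- generic space-like: the time-like plaquette below
        have hlt3 : y' 3 + 1 < c 3 + b := by
          have := (hB'.1 3).2; omega
        simp only [plaquetteEdges, mem_insert, mem_singleton] at hmem
        rcases hmem with h | h | h | h
        · -- `(y' − e₃, i')`: space-like one layer below
          rw [h] at hΛ ⊢
          rw [hτsp _ _ h3']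
          have hge : c 3 ≤ (y' - Pi.single 3 1 : Fin 4 → ℤ) 3 := ((mem_cubeEdges_iff_coords c b _ _).1 hΛ).1 3 |>.1
          rw [sub_single_apply'] at hge ⊢
          simp only [if_true] at hge ⊢
          omega
        · -- `(y' − e₃ + e_{i'}, 3)`: time-like under `ℓ'`
          rw [h] at hΛ hT ⊢
          rw [hτt]
          split_ifs with hsw2
          · omega
          · exfalso
            -- a non-side-wall free time-like link sits just under the top layer
            have hB2 := (mem_cubeEdges_iff_coords c b _ _).1 hΛ
            refine hT ⟨hΛ, rfl, fun j => ?_⟩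
            dsimp only
            have hsp : ∀ k : Fin 4, k ≠ 3 → c k + 1 ≤ (y' - Pi.single 3 1 + Pi.single i' 1 : Fin 4 → ℤ) k ∧
                (y' - Pi.single 3 1 + Pi.single i' 1 : Fin 4 → ℤ) k + 2 ≤ c k + b := by
              intro k hk
              have h1 := hB2.1 k
              have hns : ¬((y' - Pi.single 3 1 + Pi.single i' 1 : Fin 4 → ℤ) k = c k ∨ (y' - Pi.single 3 1 + Pi.single i' 1 : Fin 4 → ℤ) k + 1 = c k + b) :=
                fun h => hsw2 ⟨k, hk, h⟩
              rw [not_or] at hns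
              omega
            by_cases hj : j = 3
            · subst hj
              rw [add_single_apply', add_single_apply', sub_single_apply', if_pos rfl, if_neg (Ne.symm h3')]
              have h4 := (hB2.1 3).1
              rw [add_single_apply', sub_single_apply', if_pos rfl, if_neg (Ne.symm h3')] at h4
              omega
            · have := hsp j hj
              rw [add_single_apply' _ 3 j]
              simp only [if_neg hj, add_zero]
              exact this
        · rw [sub_add_cancel] at h; exact absurd h hne
        · -- `(y' − e₃, 3)`: time-like under the base
          rw [h] at hΛ hT ⊢
          rw [hτt]
          split_ifs with hsw2
          · omega
          · exfalso
            have hB2 := (mem_cubeEdges_iff_coords c b _ _).1 hΛ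
            refine hT ⟨hΛ, rfl, fun j => ?_⟩
            dsimp only
            have hsp : ∀ k : Fin 4, k ≠ 3 → c k + 1 ≤ (y' - Pi.single 3 1 : Fin 4 → ℤ) k ∧ (y' - Pi.single 3 1 : Fin 4 → ℤ) k + 2 ≤ c k + b := by
              intro k hk
              have h1 := hB2.1 k
              have hns : ¬((y' - Pi.single 3 1 : Fin 4 → ℤ) k = c k ∨ (y' - Pi.single 3 1 : Fin 4 → ℤ) k + 1 = c k + b) := fun h => hsw2 ⟨k, hk, h⟩
              rw [not_or] at hns
              omega
            by_cases hj : j = 3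
            · subst hj
              rw [add_single_apply', sub_single_apply', if_pos rfl]
              have h4 := (hB2.1 3).1
              rw [sub_single_apply', if_pos rfl] at h4
              omega
            · have := hsp j hj
              rw [add_single_apply' _ 3 j]
              simp only [if_neg hj, add_zero]
              exact this

end Family

/-! ### §3 The upper bound on the cold-wall cube fibre integral, every exterior -/

section Upper

variable {N : ℕ} {G : Type*} [Group G] [TopologicalSpace G] [IsTopologicalGroup G] [CompactSpace G]
  [MeasurableSpace G] [BorelSpace G] [SecondCountableTopology G] (ρ : G →* Matrix (Fin N) (Fin N) ℂ)

/-- **UPPER BOUND ON THE CUBE FIBRE INTEGRAL (every exterior).**  For a compact second-countable `G`, a continuous unitary representation `ρ`, a cube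
`(c, b)` of `ℤ⁴` with interior links `Λ` and deep temporal comb `T`, every exterior `η` and `b' ≥ 0`:
`Z_Λ(b'; η) = ∫ exp(−b' S_Λ(ζ ∨ η)) dHaar^Λ(ζ) ≤ ψ_ρ(b')^{#(Λ ∖ T)}` (`…FibrePeeling.fibreIntegral_exp_neg_mul_le_pow` on the cube's complete
triangular family). [folklore] -/
theorem fibreIntegral_exp_neg_mul_cube_le_pow (hρ : Continuous ρ) (hρU : ∀ g, ρ g ∈ Matrix.unitaryGroup (Fin N) ℂ) (c : Fin 4 → ℤ) (b : ℕ)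
    (η : LGConfig 4 G) {b' : ℝ} (hb' : 0 ≤ b') :
    ∫ ζ, Real.exp (-b' * wilsonBoundaryAction ρ (cubeEdges c b) (glueWith (cubeEdges c b) ζ η))
        ∂(Measure.pi fun _ : ↥(cubeEdges c b) => haarProbability G) ≤
      (∫⁻ V, ENNReal.ofReal (Real.exp (-(b' * ((N : ℝ) - (ρ V).trace.re)))) ∂(haarProbability G)).toReal ^
        (cubeEdges c b \ (cubeEdges c b).filter (fun ℓ => ℓ.2 = 3 ∧
          ∀ j, c j + 1 ≤ (ℓ.1 + Pi.single 3 1 : Fin 4 → ℤ) j ∧ (ℓ.1 + Pi.single 3 1 : Fin 4 → ℤ) j + 2 ≤ c j + b)).card := by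
  obtain ⟨pl, τ, h1, h2⟩ := exists_peeling_family_cube c b
  exact fibreIntegral_exp_neg_mul_le_pow ρ hρ hρU (cubeEdges c b) η hb' Finset.sdiff_subset pl τ h1 h2

/-- **The `SU(2)` reading**: for the defining representation of `SU(2)`, `b' > 0`, every cube `(c, b)` and exterior `η`:
`Z_Λ(b'; η) ≤ (3/(b'√b'))^{#(Λ ∖ T)}`. [folklore] -/
theorem fibreIntegral_exp_neg_mul_cube_le_su2 (c : Fin 4 → ℤ) (b : ℕ) (η : LGConfig 4 (Matrix.specialUnitaryGroup (Fin 2) ℂ))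
    {b' : ℝ} (hb' : 0 < b') :
    ∫ ζ, Real.exp (-b' * wilsonBoundaryAction (fundamentalRep (Fin 2)) (cubeEdges c b) (glueWith (cubeEdges c b) ζ η))
        ∂(Measure.pi fun _ : ↥(cubeEdges c b) => haarProbability (Matrix.specialUnitaryGroup (Fin 2) ℂ)) ≤
      (3 / (b' * Real.sqrt b')) ^
        (cubeEdges c b \ (cubeEdges c b).filter (fun ℓ => ℓ.2 = 3 ∧
          ∀ j, c j + 1 ≤ (ℓ.1 + Pi.single 3 1 : Fin 4 → ℤ) j ∧ (ℓ.1 + Pi.single 3 1 : Fin 4 → ℤ) j + 2 ≤ c j + b)).card := by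
  obtain ⟨pl, τ, h1, h2⟩ := exists_peeling_family_cube c b
  exact fibreIntegral_exp_neg_mul_le_su2 (cubeEdges c b) η hb' Finset.sdiff_subset pl τ h1 h2

end Upper

end Summit.QuantumFields.YangMills.Cruxes.UVSeamRec.ClassicalResponse.ColdWall

end
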